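import Literature.Analysis.PDE.SobolevEnergyLeibniz
import HarnessLib

/-!
# Leibniz bounds for the Sobolev energies with operator-valued coefficients
# (topic `Analysis/PDE`)

Analytic layer of the programme to prove short-time existence for quasilinear strictly
parabolic systems on a closed manifold (hypothesis `hQL` of
`Literature.Geometry.Riemannian.ricciFlow_shortTime_existence_of_quasilinear`). The lower-order
coefficients of the linearised operators of that programme (`𝔟 · Dv`, `𝔠 v`) are
ENDOMORPHISM-valued fields (e.g. `∂_p f(x, u, Du)` acting on `Dv`), whereas the Leibniz bounds of
`SobolevEnergyLeibniz.lean` / `SobolevLeibnizSharp.lean` are for scalar coefficients. This file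
proves the crude all-derivative Leibniz bound for a smooth field of continuous linear maps
`B : E → (F →L[ℝ] G)` applied to a smooth `g : E → F`:

* `sobolevEnergy_clm_apply_le_crude` — for every `k` there is `C < ∞` (depending on `k` and
  `dim E` only) with `E_k(x ↦ B(x) g(x)) ≤ C M² E_k(g)` whenever `‖B‖ ≤ M` and all iterated
  directional derivatives of `B` along the standard frame of orders `1, …, k` are bounded by `M`
  (induction on `k` through `∂ᵢ(B g) = B ∂ᵢg + (∂ᵢB) g`, `fderiv_clm_apply_eq`).

Lower-order terms only need a crude constant: in the weighted norms they carry the gain `λ^{-1/2}`.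

Everything is proved; no named fact and no `sorry` is introduced.

## References

* L. C. Evans, *Partial Differential Equations*, 2nd ed., AMS 2010, §5.2.3, Thm. 1 (Leibniz
  formula). [Evans2010]
-/

noncomputable section

open MeasureTheory Set Function Filter Topology
open scoped ENNReal ContDiff

namespace Literature.Analysis.PDE

open Literature.Analysis.FunctionSpaces

variable {E : Type*} [NormedAddCommGroup E] [InnerProductSpace ℝ E] [FiniteDimensional ℝ E]
  [MeasurableSpace E] [BorelSpace E]
variable {F : Type*} [NormedAddCommGroup F] [NormedSpace ℝ F]
variable {G : Type*} [NormedAddCommGroup G] [NormedSpace ℝ G]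

omit [InnerProductSpace ℝ E] [FiniteDimensional ℝ E] [MeasurableSpace E] [BorelSpace E] in
/-- Pointwise: `‖L v‖ₑ² ≤ ofReal (M²) ‖v‖ₑ²` if `‖L‖ ≤ M`. [folklore] -/
theorem enorm_clm_apply_sq_le {L : F →L[ℝ] G} {M : ℝ} (hL : ‖L‖ ≤ M) (v : F) :
    ‖L v‖ₑ ^ 2 ≤ ENNReal.ofReal (M ^ 2) * ‖v‖ₑ ^ 2 := by
  have hM : 0 ≤ M := (norm_nonneg L).trans hL
  have h : ‖L v‖ ≤ M * ‖v‖ := (L.le_opNorm v).trans (mul_le_mul_of_nonneg_right hL (norm_nonneg v))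
  have h1 : ‖L v‖ₑ ^ 2 = ENNReal.ofReal (‖L v‖ ^ 2) := by
    rw [← ofReal_norm, ENNReal.ofReal_pow (norm_nonneg _)]
  have h2 : ENNReal.ofReal (M ^ 2) * ‖v‖ₑ ^ 2 = ENNReal.ofReal ((M * ‖v‖) ^ 2) := by
    rw [mul_pow, ENNReal.ofReal_mul (sq_nonneg _), ← ofReal_norm, ENNReal.ofReal_pow (norm_nonneg _)]
  rw [h1, h2]
  exact ENNReal.ofReal_le_ofReal (pow_le_pow_left₀ (norm_nonneg _) h 2)

/-- **Order zero**: `E_0(B g) ≤ M² E_0(g)` if `‖B‖ ≤ M`. [folklore] -/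
theorem sobolevEnergy_clm_apply_le_zero {B : E → F →L[ℝ] G} {M : ℝ} (hB : ∀ x, ‖B x‖ ≤ M)
    (g : E → F) :
    sobolevEnergy 0 (fun x ↦ B x (g x)) ≤ ENNReal.ofReal (M ^ 2) * sobolevEnergy 0 g := by
  simp only [sobolevEnergy_zero_left]
  rw [← lintegral_const_mul' _ _ (by simp)]
  exact lintegral_mono fun x ↦ enorm_clm_apply_sq_le (hB x) (g x)

omit [FiniteDimensional ℝ E] [MeasurableSpace E] [BorelSpace E] in
/-- Directional derivative of `x ↦ B(x) g(x)`: `∂ᵥ(B g) = B ∂ᵥg + (∂ᵥB) g`. [folklore] -/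
theorem fderiv_clm_apply_eq {B : E → F →L[ℝ] G} {g : E → F} (hB : ContDiff ℝ ∞ B)
    (hg : ContDiff ℝ ∞ g) (x v : E) :
    fderiv ℝ (fun y ↦ B y (g y)) x v = B x (fderiv ℝ g x v) + (fderiv ℝ B x v) (g x) := by
  have hdB : DifferentiableAt ℝ B x := (hB.differentiable (by simp)) x
  have hdg : DifferentiableAt ℝ g x := (hg.differentiable (by simp)) x
  rw [fderiv_clm_apply hdB hdg]
  simp only [FunLike.coe_add, Pi.add_apply, ContinuousLinearMap.coe_comp, comp_apply,
    ContinuousLinearMap.flip_apply]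

/-- **Crude Leibniz bound with operator-valued coefficients**: for every `k` there is `C < ∞`
(depending on `k` and `dim E` only) such that `E_k(x ↦ B(x) g(x)) ≤ C M² E_k(g)` for smooth
`B : E → (F →L[ℝ] G)`, `g : E → F` with `‖B‖ ≤ M` and all iterated directional derivatives of
`B` along the standard frame of orders `1, …, k` bounded by `M`.
[cite: Evans2010, §5.2.3, Thm. 1] -/
theorem sobolevEnergy_clm_apply_le_crude (k : ℕ) :
    ∃ C : ℝ≥0∞, C ≠ ⊤ ∧ ∀ {B : E → F →L[ℝ] G} {g : E → F}, ContDiff ℝ ∞ B → ContDiff ℝ ∞ g →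
      ∀ {M : ℝ}, (∀ x, ‖B x‖ ≤ M) →
        (∀ l : List (Fin (Module.finrank ℝ E)), l ≠ [] → l.length ≤ k →
          ∀ x, ‖iterDirDeriv (l.map (stdOrthonormalBasis ℝ E)) B x‖ ≤ M) →
        sobolevEnergy k (fun x ↦ B x (g x)) ≤ C * ENNReal.ofReal (M ^ 2) * sobolevEnergy k g := by
  induction k with
  | zero =>
    refine ⟨1, ENNReal.one_ne_top, ?_⟩
    intro B g _ _ M h0 _
    rw [one_mul]
    exact sobolevEnergy_clm_apply_le_zero h0 g
  | succ k ih =>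
    obtain ⟨C, hCtop, hC⟩ := ih
    set n : ℝ≥0∞ := (Module.finrank ℝ E : ℝ≥0∞) with hn
    refine ⟨1 + 2 * C + 2 * n * C, ?_, ?_⟩
    · refine ENNReal.add_ne_top.2 ⟨ENNReal.add_ne_top.2 ⟨ENNReal.one_ne_top,
        ENNReal.mul_ne_top (by simp) hCtop⟩, ENNReal.mul_ne_top (ENNReal.mul_ne_top (by simp)
          (by rw [hn]; exact ENNReal.natCast_ne_top _)) hCtop⟩
    intro B g hB hg M h0 h1
    -- the derived coefficient fields `∂ᵢB`
    have hBi : ∀ i, ContDiff ℝ ∞ fun x ↦ fderiv ℝ B x (stdOrthonormalBasis ℝ E i) := fun i ↦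
      (hB.fderiv_right (m := ∞) (by norm_cast)).clm_apply contDiff_const
    have h0i : ∀ i x, ‖fderiv ℝ B x (stdOrthonormalBasis ℝ E i)‖ ≤ M := fun i x ↦ by
      have h := h1 [i] (by simp) (by simp) x
      simpa [FunctionSpaces.iterDirDeriv] using h
    have h1i : ∀ i, ∀ l : List (Fin (Module.finrank ℝ E)), l ≠ [] → l.length ≤ k →
        ∀ x, ‖iterDirDeriv (l.map (stdOrthonormalBasis ℝ E))
          (fun y ↦ fderiv ℝ B y (stdOrthonormalBasis ℝ E i)) x‖ ≤ M := by
      intro i l hl hlen x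
      have h := h1 (l ++ [i]) (by simp) (by simp; omega) x
      rwa [List.map_append, List.map_singleton, iterDirDeriv_append_singleton] at h
    have h1' : ∀ l : List (Fin (Module.finrank ℝ E)), l ≠ [] → l.length ≤ k →
        ∀ x, ‖iterDirDeriv (l.map (stdOrthonormalBasis ℝ E)) B x‖ ≤ M :=
      fun l hl hlen x ↦ h1 l hl (by omega) x
    have hgi : ∀ i, ContDiff ℝ ∞ fun x ↦ fderiv ℝ g x (stdOrthonormalBasis ℝ E i) := fun i ↦
      (hg.fderiv_right (m := ∞) (by norm_cast)).clm_apply contDiff_const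
    -- the two uses of the induction hypothesis
    have hIH1 : ∀ i, sobolevEnergy k (fun x ↦ B x (fderiv ℝ g x (stdOrthonormalBasis ℝ E i))) ≤
        C * ENNReal.ofReal (M ^ 2) * sobolevEnergy k (fun x ↦ fderiv ℝ g x (stdOrthonormalBasis ℝ E i)) :=
      fun i ↦ hC hB (hgi i) h0 h1'
    have hIH2 : ∀ i, sobolevEnergy k (fun x ↦ (fderiv ℝ B x (stdOrthonormalBasis ℝ E i)) (g x)) ≤
        C * ENNReal.ofReal (M ^ 2) * sobolevEnergy k g := fun i ↦ hC (hBi i) hg (h0i i) (h1i i)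
    -- unfold one level
    rw [sobolevEnergy_succ k (fun x ↦ B x (g x))]
    have hmain : ∀ i, sobolevEnergy k
        (fun x ↦ fderiv ℝ (fun y ↦ B y (g y)) x (stdOrthonormalBasis ℝ E i)) ≤
        2 * (C * ENNReal.ofReal (M ^ 2) * sobolevEnergy k (fun x ↦ fderiv ℝ g x (stdOrthonormalBasis ℝ E i))) +
          2 * (C * ENNReal.ofReal (M ^ 2) * sobolevEnergy k g) := fun i ↦ by
      have heq : (fun x ↦ fderiv ℝ (fun y ↦ B y (g y)) x (stdOrthonormalBasis ℝ E i)) =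
          fun x ↦ B x (fderiv ℝ g x (stdOrthonormalBasis ℝ E i)) +
            (fderiv ℝ B x (stdOrthonormalBasis ℝ E i)) (g x) :=
        funext fun x ↦ fderiv_clm_apply_eq hB hg x _
      rw [heq]
      have hc1 : ContDiff ℝ k fun x ↦ B x (fderiv ℝ g x (stdOrthonormalBasis ℝ E i)) :=
        (hB.clm_apply (hgi i)).of_le (by exact_mod_cast le_top)
      have hc2 : ContDiff ℝ k fun x ↦ (fderiv ℝ B x (stdOrthonormalBasis ℝ E i)) (g x) :=
        ((hBi i).clm_apply hg).of_le (by exact_mod_cast le_top)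
      exact (sobolevEnergy_add_le k hc1 hc2).trans (add_le_add (mul_le_mul' le_rfl (hIH1 i))
        (mul_le_mul' le_rfl (hIH2 i)))
    have hzero : (∫⁻ x, ‖B x (g x)‖ₑ ^ 2) ≤ ENNReal.ofReal (M ^ 2) * ∫⁻ x, ‖g x‖ₑ ^ 2 := by
      have h := sobolevEnergy_clm_apply_le_zero h0 g
      simpa only [sobolevEnergy_zero_left] using h
    -- bookkeeping
    set A := ENNReal.ofReal (M ^ 2) with hA
    set e0 := ∫⁻ x, ‖g x‖ₑ ^ 2
    set e1 := fun i ↦ sobolevEnergy k (fun x ↦ fderiv ℝ g x (stdOrthonormalBasis ℝ E i))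
    have hsum1 : ∑ i, e1 i ≤ sobolevEnergy (k + 1) g := sum_sobolevEnergy_fderiv_le k g
    have he0 : e0 ≤ sobolevEnergy (k + 1) g := lintegral_sq_le_sobolevEnergy (k + 1) g
    have hek : sobolevEnergy k g ≤ sobolevEnergy (k + 1) g := sobolevEnergy_le_succ k g
    calc (∫⁻ x, ‖B x (g x)‖ₑ ^ 2) + ∑ i, sobolevEnergy k
          (fun x ↦ fderiv ℝ (fun y ↦ B y (g y)) x (stdOrthonormalBasis ℝ E i))
        ≤ A * e0 + ∑ i, (2 * (C * A * e1 i) + 2 * (C * A * sobolevEnergy k g)) :=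
          add_le_add hzero (Finset.sum_le_sum fun i _ ↦ hmain i)
      _ = A * e0 + 2 * C * A * ∑ i, e1 i + 2 * n * C * A * sobolevEnergy k g := by
          rw [Finset.sum_add_distrib, Finset.sum_const, Finset.card_univ, Fintype.card_fin,
            ← Finset.mul_sum, ← Finset.mul_sum, nsmul_eq_mul]
          ring
      _ ≤ A * sobolevEnergy (k + 1) g + 2 * C * A * sobolevEnergy (k + 1) g +
            2 * n * C * A * sobolevEnergy (k + 1) g := by
          gcongr
      _ = (1 + 2 * C + 2 * n * C) * A * sobolevEnergy (k + 1) g := by ring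

end Literature.Analysis.PDE

end
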